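import Mathlib
import HarnessLib
import Summits.HubbardSuperconductivity.HubbardSuperconductivity.Theorems.KLProgrammeC4aTangencyCalculus
import Summits.HubbardSuperconductivity.HubbardSuperconductivity.Theorems.KLProgrammeC4aPartnerBandCooperDefectThree

/-!
# Route `KLProgramme` — crux C4a, S3 brick (B2, TANGENCY, ORDER 2): carrier-free calculus — the SECOND t-derivative of `f(2Γ(θ+t) − Γ(φ+θ+t))` is `O(φ²)` for a curve
# `Γ` inside the zero level of `f`

Cell `gate-hubbard-kl`, lane hubbard-kl-c4a-1 (g6); helper for stub (C) `stub_twoLeg_curvature` of the engine-flow child `KLRegimeEngineV17F2`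
(stmt-HubbardSuperconductivity-20437); memo HOME/hubbard-kl-c4a-1/C4A-PLAN.md §24.4 (ii), §24.8 («ORDER 2 AT (T)»).  Sequel to `…C4aTangencyCalculus` (order 1).  With `a = Γ(θ)`,
`b = Γ′(θ)`, `c = Γ″(θ)`, `d = Γ‴(θ)` and the Taylor remainders `R₀, R₁, R₂` of `Γ, Γ′, Γ″` at `θ` (`‖R_j‖ ≤ D_{j+2}φ²`): the 2-jet of the argument curve
`t ↦ Γ(θ+t) + Γ(θ+t) − Γ(φ+θ+t)` at `t = 0` is `(a − φb − R₀, b − φc − R₁, c − φd − R₂)`, and the main term `χ(φ) = D²f(a−φb)[b−φc, b−φc] + Df(a−φb)[c−φd]` has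
`χ(0) = (f∘Γ)″(θ) = 0`, `χ′(0) = −(f∘Γ)‴(θ) = 0`.

* `abs_apply₄_le`; `hasDerivAt_tangencyChi`, `hasDerivAt_tangencyChi₁`, `abs_tangencyChi₂_le`, `abs_tangencyChi_le` (the main term); **`abs_jet_two_sub_le`** — comparison of the order-2 chain expressions at two 2-jets:
  `|D²f(p)[u₁,u₁] + Df(p)[u₂] − (D²f(q)[v₁,v₁] + Df(q)[v₂])| ≤ K₃‖p−q‖‖u₁‖² + K₂‖u₁−v₁‖(‖u₁‖+‖v₁‖) + K₂‖p−q‖‖u₂‖ + K₁‖u₂−v₂‖` (the one workhorse for all reductions);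
* **`abs_iteratedDeriv_two_tangency_core_le`** — `|∂_t²|₀ f(Γ(θ+t) + Γ(θ+t) − Γ(φ+θ+t))| ≤ C₂(φ)·φ²` with
  `C₂(φ) = M₂ + K₃D₂(Y₁ + D₃φ²)² + K₂D₃(2Y₁ + D₃φ²) + K₂D₂(Y₂ + D₄φ²) + K₁D₄`, `M₂ = K₄D₁²Y₁² + 4K₃D₁D₂Y₁ + 2K₂D₂² + K₃D₁²Y₂ + 2K₂D₁D₃`, `Y₁ = D₁ + |φ|D₂`,
  `Y₂ = D₂ + |φ|D₃` (needs `f ∈ C⁴` with `‖Dʲf‖ ≤ K_j`, `j ≤ 4`, and `‖Γ^{(j)}‖ ≤ D_j`, `j ≤ 4`).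

Pure calculus; nothing about the model's sizes; nothing asserts superconductivity.  References: FST II CPAM 51 (1998) §3; BGM 2006 §2.4 [cite: BenfattoGiulianiMastropietro2006].
-/

noncomputable section

namespace Summit.HubbardSuperconductivity.HubbardSuperconductivity.Theorems.C4a

set_option linter.dupNamespace false -- summit = problem name (single-conjunct summit), D-0017
set_option maxSynthPendingDepth 4 -- nested operator-norm instances (fourth Fréchet derivatives)

open Real Set Filter
open scoped Topology
open Summit.HubbardSuperconductivity.HubbardSuperconductivity.Theorems.PerturbedFermiCurve

section Abstract

variable {V : Type*} [NormedAddCommGroup V] [NormedSpace ℝ V]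

/-- `|Q u v w s| ≤ ‖Q‖·‖u‖·‖v‖·‖w‖·‖s‖` for a continuous 4-linear form. [folklore] -/
theorem abs_apply₄_le (Q : V →L[ℝ] V →L[ℝ] V →L[ℝ] V →L[ℝ] ℝ) (u v w s : V) : |Q u v w s| ≤ ‖Q‖ * ‖u‖ * ‖v‖ * ‖w‖ * ‖s‖ :=
  (abs_apply₃_le (Q u) v w s).trans
    (mul_le_mul_of_nonneg_right (mul_le_mul_of_nonneg_right (mul_le_mul_of_nonneg_right (Q.le_opNorm u) (norm_nonneg v)) (norm_nonneg w)) (norm_nonneg s))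

/-- **Comparison of the order-2 chain expressions at two 2-jets** `(p; u₁, u₂)` and `(q; v₁, v₂)`:
`|D²f(p)[u₁,u₁] + Df(p)[u₂] − (D²f(q)[v₁,v₁] + Df(q)[v₂])| ≤ K₃‖p−q‖‖u₁‖² + K₂‖u₁−v₁‖(‖u₁‖+‖v₁‖) + K₂‖p−q‖‖u₂‖ + K₁‖u₂−v₂‖`. [folklore] -/
theorem abs_jet_two_sub_le {f : V → ℝ} (hf : ContDiff ℝ 4 f) {K₁ K₂ K₃ : ℝ} (hK₁ : ∀ x, ‖fderiv ℝ f x‖ ≤ K₁) (hK₂ : ∀ x, ‖iteratedFDeriv ℝ 2 f x‖ ≤ K₂)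
    (hK₃ : ∀ x, ‖iteratedFDeriv ℝ 3 f x‖ ≤ K₃) (p q u₁ v₁ u₂ v₂ : V) :
    |fderiv ℝ (fderiv ℝ f) p u₁ u₁ + fderiv ℝ f p u₂ - (fderiv ℝ (fderiv ℝ f) q v₁ v₁ + fderiv ℝ f q v₂)| ≤
      K₃ * ‖p - q‖ * ‖u₁‖ ^ 2 + K₂ * ‖u₁ - v₁‖ * (‖u₁‖ + ‖v₁‖) + K₂ * ‖p - q‖ * ‖u₂‖ + K₁ * ‖u₂ - v₂‖ := by
  have hK₂0 : 0 ≤ K₂ := (norm_nonneg _).trans (hK₂ q)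
  have key : fderiv ℝ (fderiv ℝ f) p u₁ u₁ + fderiv ℝ f p u₂ - (fderiv ℝ (fderiv ℝ f) q v₁ v₁ + fderiv ℝ f q v₂) =
      (fderiv ℝ (fderiv ℝ f) p - fderiv ℝ (fderiv ℝ f) q) u₁ u₁ + (fderiv ℝ (fderiv ℝ f) q (u₁ - v₁) u₁ + fderiv ℝ (fderiv ℝ f) q v₁ (u₁ - v₁)) +
        (fderiv ℝ f p - fderiv ℝ f q) u₂ + fderiv ℝ f q (u₂ - v₂) := by
    simp only [map_sub, show ∀ (P Q : V →L[ℝ] V →L[ℝ] ℝ) (z : V), (P - Q) z = P z - Q z from fun _ _ _ => rfl,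
      show ∀ (P Q : V →L[ℝ] ℝ) (z : V), (P - Q) z = P z - Q z from fun _ _ _ => rfl]
    ring
  rw [key]
  have hLip₂ : ‖fderiv ℝ (fderiv ℝ f) p - fderiv ℝ (fderiv ℝ f) q‖ ≤ K₃ * ‖p - q‖ := by
    have hdiff : Differentiable ℝ (fderiv ℝ (fderiv ℝ f)) :=
      ((hf.fderiv_right (m := 3) (by norm_num)).fderiv_right (m := 2) (by norm_num)).differentiable (by norm_num)
    exact (convex_univ (𝕜 := ℝ) (E := V)).norm_image_sub_le_of_norm_fderiv_le (𝕜 := ℝ) (f := fderiv ℝ (fderiv ℝ f)) (fun z _ => hdiff z)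
      (fun z _ => by rw [norm_fderiv_three_eq_norm_iteratedFDeriv]; exact hK₃ z) (mem_univ q) (mem_univ p)
  have hLip₁ : ‖fderiv ℝ f p - fderiv ℝ f q‖ ≤ K₂ * ‖p - q‖ := by
    have hdiff : Differentiable ℝ (fderiv ℝ f) := (hf.fderiv_right (m := 3) (by norm_num)).differentiable (by norm_num)
    exact (convex_univ (𝕜 := ℝ) (E := V)).norm_image_sub_le_of_norm_fderiv_le (𝕜 := ℝ) (f := fderiv ℝ f) (fun z _ => hdiff z)
      (fun z _ => by rw [norm_fderiv_two_eq_norm_iteratedFDeriv]; exact hK₂ z) (mem_univ q) (mem_univ p)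
  have hL₂q : ‖fderiv ℝ (fderiv ℝ f) q‖ ≤ K₂ := by rw [norm_fderiv_two_eq_norm_iteratedFDeriv]; exact hK₂ q
  have t1 : |(fderiv ℝ (fderiv ℝ f) p - fderiv ℝ (fderiv ℝ f) q) u₁ u₁| ≤ K₃ * ‖p - q‖ * ‖u₁‖ ^ 2 := by
    rw [← Real.norm_eq_abs]
    refine ((fderiv ℝ (fderiv ℝ f) p - fderiv ℝ (fderiv ℝ f) q).le_opNorm₂ u₁ u₁).trans ?_
    rw [sq, ← mul_assoc]
    exact mul_le_mul_of_nonneg_right (mul_le_mul_of_nonneg_right hLip₂ (norm_nonneg _)) (norm_nonneg _)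
  have t2 : |fderiv ℝ (fderiv ℝ f) q (u₁ - v₁) u₁ + fderiv ℝ (fderiv ℝ f) q v₁ (u₁ - v₁)| ≤ K₂ * ‖u₁ - v₁‖ * (‖u₁‖ + ‖v₁‖) := by
    have h1 := (fderiv ℝ (fderiv ℝ f) q).le_opNorm₂ (u₁ - v₁) u₁
    have h2 := (fderiv ℝ (fderiv ℝ f) q).le_opNorm₂ v₁ (u₁ - v₁)
    rw [Real.norm_eq_abs] at h1 h2
    have := abs_add_le (fderiv ℝ (fderiv ℝ f) q (u₁ - v₁) u₁) (fderiv ℝ (fderiv ℝ f) q v₁ (u₁ - v₁))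
    have h3 : ‖fderiv ℝ (fderiv ℝ f) q‖ * ‖u₁ - v₁‖ * ‖u₁‖ ≤ K₂ * ‖u₁ - v₁‖ * ‖u₁‖ := by gcongr
    have h4 : ‖fderiv ℝ (fderiv ℝ f) q‖ * ‖v₁‖ * ‖u₁ - v₁‖ ≤ K₂ * ‖v₁‖ * ‖u₁ - v₁‖ := by gcongr
    linarith
  have t3 : |(fderiv ℝ f p - fderiv ℝ f q) u₂| ≤ K₂ * ‖p - q‖ * ‖u₂‖ := by
    rw [← Real.norm_eq_abs]
    exact ((fderiv ℝ f p - fderiv ℝ f q).le_opNorm u₂).trans (mul_le_mul_of_nonneg_right hLip₁ (norm_nonneg _))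
  have t4 : |fderiv ℝ f q (u₂ - v₂)| ≤ K₁ * ‖u₂ - v₂‖ := by
    rw [← Real.norm_eq_abs]
    exact ((fderiv ℝ f q).le_opNorm _).trans (mul_le_mul_of_nonneg_right (hK₁ q) (norm_nonneg _))
  have := abs_add_le ((fderiv ℝ (fderiv ℝ f) p - fderiv ℝ (fderiv ℝ f) q) u₁ u₁ + (fderiv ℝ (fderiv ℝ f) q (u₁ - v₁) u₁ + fderiv ℝ (fderiv ℝ f) q v₁ (u₁ - v₁)) +
    (fderiv ℝ f p - fderiv ℝ f q) u₂) (fderiv ℝ f q (u₂ - v₂))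
  have := abs_add_three ((fderiv ℝ (fderiv ℝ f) p - fderiv ℝ (fderiv ℝ f) q) u₁ u₁)
    (fderiv ℝ (fderiv ℝ f) q (u₁ - v₁) u₁ + fderiv ℝ (fderiv ℝ f) q v₁ (u₁ - v₁)) ((fderiv ℝ f p - fderiv ℝ f q) u₂)
  linarith

/-! ### The main term `χ(x) = D²f(a − xb)[b − xc, b − xc] + Df(a − xb)[c − xd]` at the tangency configuration -/

/-- `χ′`: the derivative of `x ↦ D²f(a − xb)[b − xc, b − xc] + Df(a − xb)[c − xd]`. [folklore] -/
theorem hasDerivAt_tangencyChi {f : V → ℝ} (hf : ContDiff ℝ 4 f) (a b c d : V) (x : ℝ) :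
    HasDerivAt (fun y : ℝ => fderiv ℝ (fderiv ℝ f) (a - y • b) (b - y • c) (b - y • c) + fderiv ℝ f (a - y • b) (c - y • d))
      ((fderiv ℝ (fderiv ℝ (fderiv ℝ f)) (a - x • b) (-b) (b - x • c) + fderiv ℝ (fderiv ℝ f) (a - x • b) (-c)) (b - x • c) +
          fderiv ℝ (fderiv ℝ f) (a - x • b) (b - x • c) (-c) +
        (fderiv ℝ (fderiv ℝ f) (a - x • b) (-b) (c - x • d) + fderiv ℝ f (a - x • b) (-d))) x := by
  have hf1d : Differentiable ℝ (fderiv ℝ f) := (hf.fderiv_right (m := 3) (by norm_num)).differentiable (by norm_num)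
  have hf2d : Differentiable ℝ (fderiv ℝ (fderiv ℝ f)) :=
    ((hf.fderiv_right (m := 3) (by norm_num)).fderiv_right (m := 2) (by norm_num)).differentiable (by norm_num)
  have hl : HasDerivAt (fun y : ℝ => a - y • b) (-b) x := (((hasDerivAt_id' x).smul_const b).const_sub a).congr_deriv (by rw [one_smul])
  have hv₁ : HasDerivAt (fun y : ℝ => b - y • c) (-c) x := (((hasDerivAt_id' x).smul_const c).const_sub b).congr_deriv (by rw [one_smul])
  have hv₂ : HasDerivAt (fun y : ℝ => c - y • d) (-d) x := (((hasDerivAt_id' x).smul_const d).const_sub c).congr_deriv (by rw [one_smul])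
  have hL₁ : HasDerivAt (fun y : ℝ => fderiv ℝ f (a - y • b)) (fderiv ℝ (fderiv ℝ f) (a - x • b) (-b)) x :=
    (hf1d _).hasFDerivAt.comp_hasDerivAt_of_eq x hl rfl
  have hL₂ : HasDerivAt (fun y : ℝ => fderiv ℝ (fderiv ℝ f) (a - y • b)) (fderiv ℝ (fderiv ℝ (fderiv ℝ f)) (a - x • b) (-b)) x :=
    (hf2d _).hasFDerivAt.comp_hasDerivAt_of_eq x hl rfl
  exact ((hL₂.clm_apply hv₁).clm_apply hv₁).add (hL₁.clm_apply hv₂)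

/-- `χ″`: the derivative of `χ′`. [folklore] -/
theorem hasDerivAt_tangencyChi₁ {f : V → ℝ} (hf : ContDiff ℝ 4 f) (a b c d : V) (x : ℝ) :
    HasDerivAt (fun y : ℝ => (fderiv ℝ (fderiv ℝ (fderiv ℝ f)) (a - y • b) (-b) (b - y • c) + fderiv ℝ (fderiv ℝ f) (a - y • b) (-c)) (b - y • c) +
          fderiv ℝ (fderiv ℝ f) (a - y • b) (b - y • c) (-c) +
        (fderiv ℝ (fderiv ℝ f) (a - y • b) (-b) (c - y • d) + fderiv ℝ f (a - y • b) (-d)))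
      ((fderiv ℝ (fderiv ℝ (fderiv ℝ (fderiv ℝ f))) (a - x • b) (-b) (-b) (b - x • c) + fderiv ℝ (fderiv ℝ (fderiv ℝ f)) (a - x • b) (-b) (-c) +
              fderiv ℝ (fderiv ℝ (fderiv ℝ f)) (a - x • b) (-b) (-c)) (b - x • c) +
            (fderiv ℝ (fderiv ℝ (fderiv ℝ f)) (a - x • b) (-b) (b - x • c) + fderiv ℝ (fderiv ℝ f) (a - x • b) (-c)) (-c) +
          (fderiv ℝ (fderiv ℝ (fderiv ℝ f)) (a - x • b) (-b) (b - x • c) + fderiv ℝ (fderiv ℝ f) (a - x • b) (-c)) (-c) +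
        (fderiv ℝ (fderiv ℝ (fderiv ℝ f)) (a - x • b) (-b) (-b) (c - x • d) + fderiv ℝ (fderiv ℝ f) (a - x • b) (-b) (-d) +
          fderiv ℝ (fderiv ℝ f) (a - x • b) (-b) (-d))) x := by
  have hf1d : Differentiable ℝ (fderiv ℝ f) := (hf.fderiv_right (m := 3) (by norm_num)).differentiable (by norm_num)
  have hf2d : Differentiable ℝ (fderiv ℝ (fderiv ℝ f)) :=
    ((hf.fderiv_right (m := 3) (by norm_num)).fderiv_right (m := 2) (by norm_num)).differentiable (by norm_num)
  have hf3d : Differentiable ℝ (fderiv ℝ (fderiv ℝ (fderiv ℝ f))) :=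
    (((hf.fderiv_right (m := 3) (by norm_num)).fderiv_right (m := 2) (by norm_num)).fderiv_right (m := 1) (by norm_num)).differentiable one_ne_zero
  have hl : HasDerivAt (fun y : ℝ => a - y • b) (-b) x := (((hasDerivAt_id' x).smul_const b).const_sub a).congr_deriv (by rw [one_smul])
  have hv₁ : HasDerivAt (fun y : ℝ => b - y • c) (-c) x := (((hasDerivAt_id' x).smul_const c).const_sub b).congr_deriv (by rw [one_smul])
  have hv₂ : HasDerivAt (fun y : ℝ => c - y • d) (-d) x := (((hasDerivAt_id' x).smul_const d).const_sub c).congr_deriv (by rw [one_smul])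
  have hL₁ : HasDerivAt (fun y : ℝ => fderiv ℝ f (a - y • b)) (fderiv ℝ (fderiv ℝ f) (a - x • b) (-b)) x :=
    (hf1d _).hasFDerivAt.comp_hasDerivAt_of_eq x hl rfl
  have hL₂ : HasDerivAt (fun y : ℝ => fderiv ℝ (fderiv ℝ f) (a - y • b)) (fderiv ℝ (fderiv ℝ (fderiv ℝ f)) (a - x • b) (-b)) x :=
    (hf2d _).hasFDerivAt.comp_hasDerivAt_of_eq x hl rfl
  have hL₃ : HasDerivAt (fun y : ℝ => fderiv ℝ (fderiv ℝ (fderiv ℝ f)) (a - y • b)) (fderiv ℝ (fderiv ℝ (fderiv ℝ (fderiv ℝ f))) (a - x • b) (-b)) x :=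
    (hf3d _).hasFDerivAt.comp_hasDerivAt_of_eq x hl rfl
  have hW : HasDerivAt (fun y : ℝ => fderiv ℝ (fderiv ℝ f) (a - y • b) (b - y • c))
      (fderiv ℝ (fderiv ℝ (fderiv ℝ f)) (a - x • b) (-b) (b - x • c) + fderiv ℝ (fderiv ℝ f) (a - x • b) (-c)) x := hL₂.clm_apply hv₁
  have hU₁ : HasDerivAt (fun y : ℝ => fderiv ℝ (fderiv ℝ (fderiv ℝ f)) (a - y • b) (-b)) (fderiv ℝ (fderiv ℝ (fderiv ℝ (fderiv ℝ f))) (a - x • b) (-b) (-b)) x :=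
    (hL₃.clm_apply (hasDerivAt_const x (-b))).congr_deriv (by rw [map_zero, add_zero])
  have hU : HasDerivAt (fun y : ℝ => fderiv ℝ (fderiv ℝ (fderiv ℝ f)) (a - y • b) (-b) (b - y • c) + fderiv ℝ (fderiv ℝ f) (a - y • b) (-c))
      (fderiv ℝ (fderiv ℝ (fderiv ℝ (fderiv ℝ f))) (a - x • b) (-b) (-b) (b - x • c) + fderiv ℝ (fderiv ℝ (fderiv ℝ f)) (a - x • b) (-b) (-c) +
        fderiv ℝ (fderiv ℝ (fderiv ℝ f)) (a - x • b) (-b) (-c)) x :=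
    (hU₁.clm_apply hv₁).add ((hL₂.clm_apply (hasDerivAt_const x (-c))).congr_deriv (by rw [map_zero, add_zero]))
  have hS₃ : HasDerivAt (fun y : ℝ => fderiv ℝ (fderiv ℝ f) (a - y • b) (-b)) (fderiv ℝ (fderiv ℝ (fderiv ℝ f)) (a - x • b) (-b) (-b)) x :=
    (hL₂.clm_apply (hasDerivAt_const x (-b))).congr_deriv (by rw [map_zero, add_zero])
  exact ((hU.clm_apply hv₁).add ((hW.clm_apply (hasDerivAt_const x (-c))).congr_deriv (by rw [map_zero, add_zero]))).add
    ((hS₃.clm_apply hv₂).add ((hL₁.clm_apply (hasDerivAt_const x (-d))).congr_deriv (by rw [map_zero, add_zero])))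

/-- `|χ″(x)| ≤ M₂` for `|x| ≤ |φ|`, `M₂ = K₄D₁²Y₁² + 4K₃D₁D₂Y₁ + 2K₂D₂² + K₃D₁²Y₂ + 2K₂D₁D₃` (`Y₁ = D₁ + |φ|D₂`, `Y₂ = D₂ + |φ|D₃`). [folklore] -/
theorem abs_tangencyChi₂_le {f : V → ℝ} {K₂ K₃ K₄ : ℝ} (hK₂ : ∀ x, ‖iteratedFDeriv ℝ 2 f x‖ ≤ K₂) (hK₃ : ∀ x, ‖iteratedFDeriv ℝ 3 f x‖ ≤ K₃)
    (hK₄ : ∀ x, ‖iteratedFDeriv ℝ 4 f x‖ ≤ K₄) (a : V) {b c d : V} {D₁ D₂ D₃ : ℝ} (hb : ‖b‖ ≤ D₁) (hc : ‖c‖ ≤ D₂) (hd : ‖d‖ ≤ D₃) {φ x : ℝ}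
    (hx : |x| ≤ |φ|) :
    |(fderiv ℝ (fderiv ℝ (fderiv ℝ (fderiv ℝ f))) (a - x • b) (-b) (-b) (b - x • c) + fderiv ℝ (fderiv ℝ (fderiv ℝ f)) (a - x • b) (-b) (-c) +
              fderiv ℝ (fderiv ℝ (fderiv ℝ f)) (a - x • b) (-b) (-c)) (b - x • c) +
            (fderiv ℝ (fderiv ℝ (fderiv ℝ f)) (a - x • b) (-b) (b - x • c) + fderiv ℝ (fderiv ℝ f) (a - x • b) (-c)) (-c) +
          (fderiv ℝ (fderiv ℝ (fderiv ℝ f)) (a - x • b) (-b) (b - x • c) + fderiv ℝ (fderiv ℝ f) (a - x • b) (-c)) (-c) +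
        (fderiv ℝ (fderiv ℝ (fderiv ℝ f)) (a - x • b) (-b) (-b) (c - x • d) + fderiv ℝ (fderiv ℝ f) (a - x • b) (-b) (-d) +
          fderiv ℝ (fderiv ℝ f) (a - x • b) (-b) (-d))| ≤
      K₄ * D₁ ^ 2 * (D₁ + |φ| * D₂) ^ 2 + 4 * K₃ * D₁ * D₂ * (D₁ + |φ| * D₂) + 2 * K₂ * D₂ ^ 2 + K₃ * D₁ ^ 2 * (D₂ + |φ| * D₃) + 2 * K₂ * D₁ * D₃ := by
  have hK₂0 : 0 ≤ K₂ := (norm_nonneg _).trans (hK₂ a)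
  have hK₃0 : 0 ≤ K₃ := (norm_nonneg _).trans (hK₃ a)
  have hK₄0 : 0 ≤ K₄ := (norm_nonneg _).trans (hK₄ a)
  have hD₁0 : 0 ≤ D₁ := (norm_nonneg _).trans hb
  have hD₂0 : 0 ≤ D₂ := (norm_nonneg _).trans hc
  have hD₃0 : 0 ≤ D₃ := (norm_nonneg _).trans hd
  set z := a - x • b with hz
  set y₁ := b - x • c with hy₁
  set y₂ := c - x • d with hy₂
  have hL4 : ‖fderiv ℝ (fderiv ℝ (fderiv ℝ (fderiv ℝ f))) z‖ ≤ K₄ := by rw [norm_fderiv_four_eq_norm_iteratedFDeriv]; exact hK₄ _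
  have hL3 : ‖fderiv ℝ (fderiv ℝ (fderiv ℝ f)) z‖ ≤ K₃ := by rw [norm_fderiv_three_eq_norm_iteratedFDeriv]; exact hK₃ _
  have hL2 : ‖fderiv ℝ (fderiv ℝ f) z‖ ≤ K₂ := by rw [norm_fderiv_two_eq_norm_iteratedFDeriv]; exact hK₂ _
  have hnb : ‖-b‖ ≤ D₁ := by rw [norm_neg]; exact hb
  have hnc : ‖-c‖ ≤ D₂ := by rw [norm_neg]; exact hc
  have hnd : ‖-d‖ ≤ D₃ := by rw [norm_neg]; exact hd
  have hY₁ : ‖y₁‖ ≤ D₁ + |φ| * D₂ :=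
    (norm_sub_le _ _).trans (add_le_add hb (by rw [norm_smul, Real.norm_eq_abs]; exact mul_le_mul hx hc (norm_nonneg _) (abs_nonneg _)))
  have hY₂ : ‖y₂‖ ≤ D₂ + |φ| * D₃ :=
    (norm_sub_le _ _).trans (add_le_add hc (by rw [norm_smul, Real.norm_eq_abs]; exact mul_le_mul hx hd (norm_nonneg _) (abs_nonneg _)))
  simp only [show ∀ (P Q : V →L[ℝ] ℝ) (w : V), (P + Q) w = P w + Q w from fun _ _ _ => rfl]
  have t1 : |fderiv ℝ (fderiv ℝ (fderiv ℝ (fderiv ℝ f))) z (-b) (-b) y₁ y₁| ≤ K₄ * D₁ ^ 2 * (D₁ + |φ| * D₂) ^ 2 := by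
    refine (abs_apply₄_le _ _ _ _ _).trans ?_
    calc ‖fderiv ℝ (fderiv ℝ (fderiv ℝ (fderiv ℝ f))) z‖ * ‖-b‖ * ‖-b‖ * ‖y₁‖ * ‖y₁‖ ≤ K₄ * D₁ * D₁ * (D₁ + |φ| * D₂) * (D₁ + |φ| * D₂) := by gcongr
      _ = K₄ * D₁ ^ 2 * (D₁ + |φ| * D₂) ^ 2 := by ring
  have t2 : |fderiv ℝ (fderiv ℝ (fderiv ℝ f)) z (-b) (-c) y₁| ≤ K₃ * D₁ * D₂ * (D₁ + |φ| * D₂) :=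
    (abs_apply₃_le _ _ _ _).trans (by gcongr)
  have t3 : |fderiv ℝ (fderiv ℝ (fderiv ℝ f)) z (-b) y₁ (-c)| ≤ K₃ * D₁ * (D₁ + |φ| * D₂) * D₂ :=
    (abs_apply₃_le _ _ _ _).trans (by gcongr)
  have t4 : |fderiv ℝ (fderiv ℝ f) z (-c) (-c)| ≤ K₂ * D₂ * D₂ := by
    rw [← Real.norm_eq_abs]; exact ((fderiv ℝ (fderiv ℝ f) z).le_opNorm₂ _ _).trans (by gcongr)
  have t5 : |fderiv ℝ (fderiv ℝ (fderiv ℝ f)) z (-b) (-b) y₂| ≤ K₃ * D₁ * D₁ * (D₂ + |φ| * D₃) :=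
    (abs_apply₃_le _ _ _ _).trans (by gcongr)
  have t6 : |fderiv ℝ (fderiv ℝ f) z (-b) (-d)| ≤ K₂ * D₁ * D₃ := by
    rw [← Real.norm_eq_abs]; exact ((fderiv ℝ (fderiv ℝ f) z).le_opNorm₂ _ _).trans (by gcongr)
  have := abs_add_three (fderiv ℝ (fderiv ℝ (fderiv ℝ (fderiv ℝ f))) z (-b) (-b) y₁ y₁) (fderiv ℝ (fderiv ℝ (fderiv ℝ f)) z (-b) (-c) y₁)
    (fderiv ℝ (fderiv ℝ (fderiv ℝ f)) z (-b) (-c) y₁)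
  have := abs_add_le (fderiv ℝ (fderiv ℝ (fderiv ℝ f)) z (-b) y₁ (-c)) (fderiv ℝ (fderiv ℝ f) z (-c) (-c))
  have := abs_add_three (fderiv ℝ (fderiv ℝ (fderiv ℝ f)) z (-b) (-b) y₂) (fderiv ℝ (fderiv ℝ f) z (-b) (-d)) (fderiv ℝ (fderiv ℝ f) z (-b) (-d))
  have := abs_add_three
    (fderiv ℝ (fderiv ℝ (fderiv ℝ (fderiv ℝ f))) z (-b) (-b) y₁ y₁ + fderiv ℝ (fderiv ℝ (fderiv ℝ f)) z (-b) (-c) y₁ + fderiv ℝ (fderiv ℝ (fderiv ℝ f)) z (-b) (-c) y₁)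
    (fderiv ℝ (fderiv ℝ (fderiv ℝ f)) z (-b) y₁ (-c) + fderiv ℝ (fderiv ℝ f) z (-c) (-c))
    (fderiv ℝ (fderiv ℝ (fderiv ℝ f)) z (-b) y₁ (-c) + fderiv ℝ (fderiv ℝ f) z (-c) (-c))
  have := abs_add_le
    (fderiv ℝ (fderiv ℝ (fderiv ℝ (fderiv ℝ f))) z (-b) (-b) y₁ y₁ + fderiv ℝ (fderiv ℝ (fderiv ℝ f)) z (-b) (-c) y₁ + fderiv ℝ (fderiv ℝ (fderiv ℝ f)) z (-b) (-c) y₁ +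
        (fderiv ℝ (fderiv ℝ (fderiv ℝ f)) z (-b) y₁ (-c) + fderiv ℝ (fderiv ℝ f) z (-c) (-c)) +
      (fderiv ℝ (fderiv ℝ (fderiv ℝ f)) z (-b) y₁ (-c) + fderiv ℝ (fderiv ℝ f) z (-c) (-c)))
    (fderiv ℝ (fderiv ℝ (fderiv ℝ f)) z (-b) (-b) y₂ + fderiv ℝ (fderiv ℝ f) z (-b) (-d) + fderiv ℝ (fderiv ℝ f) z (-b) (-d))
  linarith [t1, t2, t3, t4, t5, t6]

/-- **`|χ(φ)| ≤ M₂·φ²`** when `(a; b, c, d)` is the 3-jet of a curve in the zero level of `f` at one point: `D²f(a)[b,b] + Df(a)[c] = 0` and the order-3 chain expression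
vanishes. -/
theorem abs_tangencyChi_le {f : V → ℝ} (hf : ContDiff ℝ 4 f) {K₂ K₃ K₄ : ℝ} (hK₂ : ∀ x, ‖iteratedFDeriv ℝ 2 f x‖ ≤ K₂) (hK₃ : ∀ x, ‖iteratedFDeriv ℝ 3 f x‖ ≤ K₃)
    (hK₄ : ∀ x, ‖iteratedFDeriv ℝ 4 f x‖ ≤ K₄) {a b c d : V}
    (h2 : fderiv ℝ (fderiv ℝ f) a b b + fderiv ℝ f a c = 0)
    (h3 : fderiv ℝ (fderiv ℝ (fderiv ℝ f)) a b b b + fderiv ℝ (fderiv ℝ f) a c b + fderiv ℝ (fderiv ℝ f) a b c +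
      (fderiv ℝ (fderiv ℝ f) a b c + fderiv ℝ f a d) = 0)
    {D₁ D₂ D₃ : ℝ} (hb : ‖b‖ ≤ D₁) (hc : ‖c‖ ≤ D₂) (hd : ‖d‖ ≤ D₃) (φ : ℝ) :
    |fderiv ℝ (fderiv ℝ f) (a - φ • b) (b - φ • c) (b - φ • c) + fderiv ℝ f (a - φ • b) (c - φ • d)| ≤
      (K₄ * D₁ ^ 2 * (D₁ + |φ| * D₂) ^ 2 + 4 * K₃ * D₁ * D₂ * (D₁ + |φ| * D₂) + 2 * K₂ * D₂ ^ 2 + K₃ * D₁ ^ 2 * (D₂ + |φ| * D₃) + 2 * K₂ * D₁ * D₃) * φ ^ 2 := by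
  refine abs_le_sq_of_hasDerivAt_two (hasDerivAt_tangencyChi hf a b c d) (hasDerivAt_tangencyChi₁ hf a b c d) ?_ ?_
    (fun x hx => abs_tangencyChi₂_le hK₂ hK₃ hK₄ a hb hc hd hx)
  · show fderiv ℝ (fderiv ℝ f) (a - (0 : ℝ) • b) (b - (0 : ℝ) • c) (b - (0 : ℝ) • c) + fderiv ℝ f (a - (0 : ℝ) • b) (c - (0 : ℝ) • d) = 0
    simp only [zero_smul, sub_zero]; exact h2
  · show (fderiv ℝ (fderiv ℝ (fderiv ℝ f)) (a - (0 : ℝ) • b) (-b) (b - (0 : ℝ) • c) + fderiv ℝ (fderiv ℝ f) (a - (0 : ℝ) • b) (-c)) (b - (0 : ℝ) • c) +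
          fderiv ℝ (fderiv ℝ f) (a - (0 : ℝ) • b) (b - (0 : ℝ) • c) (-c) +
        (fderiv ℝ (fderiv ℝ f) (a - (0 : ℝ) • b) (-b) (c - (0 : ℝ) • d) + fderiv ℝ f (a - (0 : ℝ) • b) (-d)) = 0
    simp only [zero_smul, sub_zero, map_neg, show ∀ (P Q : V →L[ℝ] ℝ) (z : V), (P + Q) z = P z + Q z from fun _ _ _ => rfl,
      show ∀ (P : V →L[ℝ] ℝ) (z : V), (-P) z = -(P z) from fun _ _ => rfl, show ∀ (P : V →L[ℝ] V →L[ℝ] ℝ) (z : V), (-P) z = -(P z) from fun _ _ => rfl]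
    linear_combination (-1 : ℝ) * h3

/-! ### The order-2 tangency core -/

/-- **THE TANGENCY CORE AT ORDER 2**: for `f ∈ C⁴` with `‖Dʲf‖ ≤ K_j` (`j ≤ 4`), a `C⁴` curve `Γ` in the zero level of `f` with `‖Γ^{(j)}‖ ≤ D_j` (`j ≤ 4`), and all `θ, φ`:
`|∂_t²|₀ f(Γ(θ+t) + Γ(θ+t) − Γ(φ+θ+t))| ≤ C₂(φ)·φ²` — the second co-moving jet of the pp partner band also vanishes to second order in the loop angle at the tangency point. -/
theorem abs_iteratedDeriv_two_tangency_core_le {f : V → ℝ} (hf : ContDiff ℝ 4 f) {K₁ K₂ K₃ K₄ : ℝ} (hK₁ : ∀ x, ‖fderiv ℝ f x‖ ≤ K₁)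
    (hK₂ : ∀ x, ‖iteratedFDeriv ℝ 2 f x‖ ≤ K₂) (hK₃ : ∀ x, ‖iteratedFDeriv ℝ 3 f x‖ ≤ K₃) (hK₄ : ∀ x, ‖iteratedFDeriv ℝ 4 f x‖ ≤ K₄) {Γ : ℝ → V}
    (hΓ : ContDiff ℝ 4 Γ) (hΓ0 : ∀ s, f (Γ s) = 0) {D₁ D₂ D₃ D₄ : ℝ} (hD₁ : ∀ s, ‖iteratedDeriv 1 Γ s‖ ≤ D₁) (hD₂ : ∀ s, ‖iteratedDeriv 2 Γ s‖ ≤ D₂)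
    (hD₃ : ∀ s, ‖iteratedDeriv 3 Γ s‖ ≤ D₃) (hD₄ : ∀ s, ‖iteratedDeriv 4 Γ s‖ ≤ D₄) (θ φ : ℝ) :
    |iteratedDeriv 2 (fun t : ℝ => f (Γ (θ + t) + Γ (θ + t) - Γ (φ + θ + t))) 0| ≤
      (K₄ * D₁ ^ 2 * (D₁ + |φ| * D₂) ^ 2 + 4 * K₃ * D₁ * D₂ * (D₁ + |φ| * D₂) + 2 * K₂ * D₂ ^ 2 + K₃ * D₁ ^ 2 * (D₂ + |φ| * D₃) + 2 * K₂ * D₁ * D₃ +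
          K₃ * D₂ * (D₁ + |φ| * D₂ + D₃ * φ ^ 2) ^ 2 + K₂ * D₃ * (2 * (D₁ + |φ| * D₂) + D₃ * φ ^ 2) + K₂ * D₂ * (D₂ + |φ| * D₃ + D₄ * φ ^ 2) + K₁ * D₄) *
        φ ^ 2 := by
  have hK₁0 : 0 ≤ K₁ := (norm_nonneg _).trans (hK₁ 0)
  have hK₂0 : 0 ≤ K₂ := (norm_nonneg _).trans (hK₂ 0)
  have hK₃0 : 0 ≤ K₃ := (norm_nonneg _).trans (hK₃ 0)
  have hD₁0 : 0 ≤ D₁ := (norm_nonneg _).trans (hD₁ 0)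
  have hD₂0 : 0 ≤ D₂ := (norm_nonneg _).trans (hD₂ 0)
  have hD₃0 : 0 ≤ D₃ := (norm_nonneg _).trans (hD₃ 0)
  have hD₄0 : 0 ≤ D₄ := (norm_nonneg _).trans (hD₄ 0)
  -- derivative towers
  have hΓd : ∀ s, HasDerivAt Γ (iteratedDeriv 1 Γ s) s := fun s => by
    have h := hasDerivAt_iteratedDeriv_of_contDiff_four hΓ (show 0 < 4 by norm_num) s
    rwa [iteratedDeriv_zero] at h
  have hΓ1d : ∀ s, HasDerivAt (iteratedDeriv 1 Γ) (iteratedDeriv 2 Γ s) s := fun s =>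
    hasDerivAt_iteratedDeriv_of_contDiff_four hΓ (show 1 < 4 by norm_num) s
  have hΓ2d : ∀ s, HasDerivAt (iteratedDeriv 2 Γ) (iteratedDeriv 3 Γ s) s := fun s =>
    hasDerivAt_iteratedDeriv_of_contDiff_four hΓ (show 2 < 4 by norm_num) s
  have hΓ3d : ∀ s, HasDerivAt (iteratedDeriv 3 Γ) (iteratedDeriv 4 Γ s) s := fun s =>
    hasDerivAt_iteratedDeriv_of_contDiff_four hΓ (show 3 < 4 by norm_num) s
  -- the curve sits in the zero level: `(f∘Γ)″ = (f∘Γ)‴ = 0`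
  have hconst : f ∘ Γ = fun _ => (0 : ℝ) := funext fun s => hΓ0 s
  have hc2 : fderiv ℝ (fderiv ℝ f) (Γ θ) (iteratedDeriv 1 Γ θ) (iteratedDeriv 1 Γ θ) + fderiv ℝ f (Γ θ) (iteratedDeriv 2 Γ θ) = 0 := by
    rw [← iteratedDeriv_two_comp_eq hf hΓ θ, hconst, iteratedDeriv_const]; simp
  have hc3 : fderiv ℝ (fderiv ℝ (fderiv ℝ f)) (Γ θ) (iteratedDeriv 1 Γ θ) (iteratedDeriv 1 Γ θ) (iteratedDeriv 1 Γ θ) +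
      fderiv ℝ (fderiv ℝ f) (Γ θ) (iteratedDeriv 2 Γ θ) (iteratedDeriv 1 Γ θ) + fderiv ℝ (fderiv ℝ f) (Γ θ) (iteratedDeriv 1 Γ θ) (iteratedDeriv 2 Γ θ) +
      (fderiv ℝ (fderiv ℝ f) (Γ θ) (iteratedDeriv 1 Γ θ) (iteratedDeriv 2 Γ θ) + fderiv ℝ f (Γ θ) (iteratedDeriv 3 Γ θ)) = 0 := by
    rw [← iteratedDeriv_three_comp_eq hf hΓ θ, hconst, iteratedDeriv_const]; simp
  -- Taylor remainders of `Γ`, `Γ′`, `Γ″` at `θ`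
  have hR₀n : ‖Γ (φ + θ) - Γ θ - φ • iteratedDeriv 1 Γ θ‖ ≤ D₂ * φ ^ 2 := by
    have h := norm_sub_sub_smul_le_sq (g := fun x : ℝ => Γ (x + θ)) (g₁ := fun x : ℝ => iteratedDeriv 1 Γ (x + θ))
      (g₂ := fun x : ℝ => iteratedDeriv 2 Γ (x + θ)) (fun x => HasDerivAt.comp_add_const x θ (hΓd (x + θ)))
      (fun x => HasDerivAt.comp_add_const x θ (hΓ1d (x + θ))) (φ := φ) (M := D₂) (fun x _ => hD₂ (x + θ))
    simpa only [zero_add] using h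
  have hR₁n : ‖iteratedDeriv 1 Γ (φ + θ) - iteratedDeriv 1 Γ θ - φ • iteratedDeriv 2 Γ θ‖ ≤ D₃ * φ ^ 2 := by
    have h := norm_sub_sub_smul_le_sq (g := fun x : ℝ => iteratedDeriv 1 Γ (x + θ)) (g₁ := fun x : ℝ => iteratedDeriv 2 Γ (x + θ))
      (g₂ := fun x : ℝ => iteratedDeriv 3 Γ (x + θ)) (fun x => HasDerivAt.comp_add_const x θ (hΓ1d (x + θ)))
      (fun x => HasDerivAt.comp_add_const x θ (hΓ2d (x + θ))) (φ := φ) (M := D₃) (fun x _ => hD₃ (x + θ))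
    simpa only [zero_add] using h
  have hR₂n : ‖iteratedDeriv 2 Γ (φ + θ) - iteratedDeriv 2 Γ θ - φ • iteratedDeriv 3 Γ θ‖ ≤ D₄ * φ ^ 2 := by
    have h := norm_sub_sub_smul_le_sq (g := fun x : ℝ => iteratedDeriv 2 Γ (x + θ)) (g₁ := fun x : ℝ => iteratedDeriv 3 Γ (x + θ))
      (g₂ := fun x : ℝ => iteratedDeriv 4 Γ (x + θ)) (fun x => HasDerivAt.comp_add_const x θ (hΓ2d (x + θ)))
      (fun x => HasDerivAt.comp_add_const x θ (hΓ3d (x + θ))) (φ := φ) (M := D₄) (fun x _ => hD₄ (x + θ))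
    simpa only [zero_add] using h
  -- the 2-jet of the argument curve at `t = 0`
  have hg₁ : ContDiff ℝ 4 (fun t : ℝ => Γ (θ + t)) := hΓ.comp (contDiff_const.add contDiff_id)
  have hg₂ : ContDiff ℝ 4 (fun t : ℝ => Γ (φ + θ + t)) := hΓ.comp (contDiff_const.add contDiff_id)
  have hc : ContDiff ℝ 4 (fun t : ℝ => Γ (θ + t) + Γ (θ + t) - Γ (φ + θ + t)) := (hg₁.add hg₁).sub hg₂
  have hjet : ∀ {j : ℕ}, j ≤ 2 →
      iteratedDeriv j (fun t : ℝ => Γ (θ + t) + Γ (θ + t) - Γ (φ + θ + t)) 0 = iteratedDeriv j Γ θ + iteratedDeriv j Γ θ - iteratedDeriv j Γ (φ + θ) := fun {j} hj => by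
    have hj4 : (j : WithTop ℕ∞) ≤ 4 := by exact_mod_cast (hj.trans (by norm_num : 2 ≤ 4))
    rw [iteratedDeriv_fun_sub ((hg₁.add hg₁).contDiffAt.of_le hj4) (hg₂.contDiffAt.of_le hj4),
      iteratedDeriv_fun_add (hg₁.contDiffAt.of_le hj4) (hg₁.contDiffAt.of_le hj4), iteratedDeriv_comp_const_add, iteratedDeriv_comp_const_add]
    simp only [add_zero]
  have hfun : (fun t : ℝ => f (Γ (θ + t) + Γ (θ + t) - Γ (φ + θ + t))) = f ∘ fun t : ℝ => Γ (θ + t) + Γ (θ + t) - Γ (φ + θ + t) := rfl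
  rw [hfun, iteratedDeriv_two_comp_eq hf hc 0, hjet (j := 2) le_rfl, hjet (j := 1) (by norm_num)]
  simp only [add_zero]
  -- abbreviations
  set a := Γ θ with ha
  set b := iteratedDeriv 1 Γ θ with hb
  set c := iteratedDeriv 2 Γ θ with hc'
  set d := iteratedDeriv 3 Γ θ with hd'
  set R₀ := Γ (φ + θ) - a - φ • b with hR₀
  set R₁ := iteratedDeriv 1 Γ (φ + θ) - b - φ • c with hR₁
  set R₂ := iteratedDeriv 2 Γ (φ + θ) - c - φ • d with hR₂
  have hbn : ‖b‖ ≤ D₁ := hD₁ θ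
  have hcn : ‖c‖ ≤ D₂ := hD₂ θ
  have hdn : ‖d‖ ≤ D₃ := hD₃ θ
  have e0 : a + a - Γ (φ + θ) = (a - φ • b) - R₀ := by rw [hR₀]; abel
  have e1 : b + b - iteratedDeriv 1 Γ (φ + θ) = (b - φ • c) - R₁ := by rw [hR₁]; abel
  have e2 : c + c - iteratedDeriv 2 Γ (φ + θ) = (c - φ • d) - R₂ := by rw [hR₂]; abel
  rw [e0, e1, e2]
  -- the main term
  have hχ := abs_tangencyChi_le hf hK₂ hK₃ hK₄ hc2 hc3 hbn hcn hdn φ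
  -- the remainder corrections, by the 2-jet comparison
  have hJ := abs_jet_two_sub_le hf hK₁ hK₂ hK₃ (a - φ • b - R₀) (a - φ • b) (b - φ • c - R₁) (b - φ • c) (c - φ • d - R₂) (c - φ • d)
  rw [show a - φ • b - R₀ - (a - φ • b) = -R₀ by abel, show b - φ • c - R₁ - (b - φ • c) = -R₁ by abel, show c - φ • d - R₂ - (c - φ • d) = -R₂ by abel,
    norm_neg, norm_neg, norm_neg] at hJ
  have hy₁ : ‖b - φ • c‖ ≤ D₁ + |φ| * D₂ :=
    (norm_sub_le _ _).trans (add_le_add hbn (by rw [norm_smul, Real.norm_eq_abs]; exact mul_le_mul_of_nonneg_left hcn (abs_nonneg _)))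
  have hy₂ : ‖c - φ • d‖ ≤ D₂ + |φ| * D₃ :=
    (norm_sub_le _ _).trans (add_le_add hcn (by rw [norm_smul, Real.norm_eq_abs]; exact mul_le_mul_of_nonneg_left hdn (abs_nonneg _)))
  have hu₁ : ‖b - φ • c - R₁‖ ≤ D₁ + |φ| * D₂ + D₃ * φ ^ 2 := (norm_sub_le _ _).trans (add_le_add hy₁ hR₁n)
  have hu₂ : ‖c - φ • d - R₂‖ ≤ D₂ + |φ| * D₃ + D₄ * φ ^ 2 := (norm_sub_le _ _).trans (add_le_add hy₂ hR₂n)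
  have s1 : K₃ * ‖R₀‖ * ‖b - φ • c - R₁‖ ^ 2 ≤ K₃ * (D₂ * φ ^ 2) * (D₁ + |φ| * D₂ + D₃ * φ ^ 2) ^ 2 := by gcongr
  have s2 : K₂ * ‖R₁‖ * (‖b - φ • c - R₁‖ + ‖b - φ • c‖) ≤ K₂ * (D₃ * φ ^ 2) * (D₁ + |φ| * D₂ + D₃ * φ ^ 2 + (D₁ + |φ| * D₂)) := by gcongr
  have s3 : K₂ * ‖R₀‖ * ‖c - φ • d - R₂‖ ≤ K₂ * (D₂ * φ ^ 2) * (D₂ + |φ| * D₃ + D₄ * φ ^ 2) := by gcongr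
  have s4 : K₁ * ‖R₂‖ ≤ K₁ * (D₄ * φ ^ 2) := by gcongr
  have tri := abs_sub_abs_le_abs_sub (fderiv ℝ (fderiv ℝ f) (a - φ • b - R₀) (b - φ • c - R₁) (b - φ • c - R₁) + fderiv ℝ f (a - φ • b - R₀) (c - φ • d - R₂))
    (fderiv ℝ (fderiv ℝ f) (a - φ • b) (b - φ • c) (b - φ • c) + fderiv ℝ f (a - φ • b) (c - φ • d))
  linarith [hJ, hχ, s1, s2, s3, s4]

end Abstract

end Summit.HubbardSuperconductivity.HubbardSuperconductivity.Theorems.C4a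

end
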